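import Mathlib.Analysis.Complex.CauchyIntegral
import Mathlib.RingTheory.MvPowerSeries.Inverse
import Mathlib.RingTheory.MvPowerSeries.Trunc
import Mathlib.RingTheory.MvPolynomial.Homogeneous
import Mathlib.Topology.Algebra.MvPolynomial
import HarnessLib

/-!
# Taylor coefficients of `1/p` for a polynomial `p` with no zero on a closed polydisc

For a polynomial `P ∈ ℂ[z_σ]` (`σ` finite) with no zero on the closed polydisc of radius `r`,
the coefficients `b_α = [z^α] P⁻¹` of its inverse power series (Mathlib `MvPowerSeries` inverse,
`P(0) ≠ 0`) satisfy the Cauchy estimate `‖b_α‖ ≤ K r^{-|α|}` (`norm_coeff_inv_le`), hence are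
absolutely summable as soon as `r > 1` (`summable_norm_coeff_inv`); and a polynomial with no zero
on the closed unit polydisc has no zero on a slightly larger closed polydisc
(`exists_radius_gt_one_of_noZero`). Together: **a strongly `𝔻^σ`-stable polynomial has an
absolutely summable inverse power series** — the content of "`‖g_ρ‖_𝒜 < ∞`" in the first lines of
the proof of [GrinshpanEtAl2015, Thm. 3.1] (there obtained from [GrinshpanEtAl2016, Lemma 3.3],
Oka–Weil + Taylor's functional calculus); it is the analytic input of the hereditary
Positivstellensatz argument for contractive determinantal representations
(`Literature/Analysis/OperatorTheory/ContractiveDeterminantalRepresentations.lean`).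

## The argument (elementary, one complex variable at a time)

* `circleIntegral_inv_eval_smul`: for `z` in the closed unit polydisc, the degree-`k` homogeneous
  part `H_k(z) = Σ_{|α|=k} b_α z^α` equals `(2πi)⁻¹ ∮_{|t|=r} P(tz)⁻¹ t^{-(k+1)} dt`. Proof: with
  `B = truncTotal (k+1) P⁻¹` one has `P·B = 1 + E`, `E` without monomials of degree `≤ k`
  (`coeff_mul_truncTotal_inv`), so along the ray `E(tz) = t^{k+1} h̃(t)` (`eval_smul_defect`) and
  `P(tz)⁻¹ t^{-(k+1)} = B(tz) t^{-(k+1)} − h̃(t)/P(tz)`; the first term integrates to `2πi H_k(z)`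
  by orthogonality of `t^n` on the circle (`circleIntegral_sum_mul_pow_mul_zpow`), the second to
  `0` by Cauchy's theorem (Mathlib `Complex.circleIntegral_eq_zero_of_differentiable_on_off_countable`).
* hence `‖H_k(z)‖ ≤ K r^{-k}` on the unit polydisc, and a coefficient of a polynomial is bounded by
  its sup on the unit polydisc (`norm_coeff_le_of_forall_norm_eval_le`, by the Kronecker
  substitution `z_j = t^{D^j}` and the same circle orthogonality);
* `Σ_α x^{|α|} < ∞` for `0 ≤ x < 1` (`summable_pow_degree`, counting `#{|α| = k} ≤ (k+1)^{#σ}`).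

Mathlib has one-variable Cauchy theory (`circleIntegral`, `cauchyPowerSeries`) but no polydisc
Cauchy estimates; nothing here is specific to the papers cited, all statements are folklore.
Grouping namespace `GKVVW` (the two papers below).

## References

* [GrinshpanEtAl2015] A. Grinshpan, D. S. Kaliuzhnyi-Verbovetskyi, V. Vinnikov, H. J. Woerdeman,
  Contractive determinantal representations of stable polynomials on a matrix polyball,
  Math. Z. 283 (2016) 25–37, proof of Thm. 3.1 (first paragraph).
* [GrinshpanEtAl2016] the same, Matrix-valued Hermitian Positivstellensatz, lurking contractions,
  and contractive determinantal representations of stable polynomials, Oper. Theory Adv. Appl. 255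
  (2016) 123–136, Lemma 3.3.
-/

noncomputable section

open MvPolynomial Complex Metric Finset
open scoped Real

namespace Literature.Analysis.OperatorTheory
namespace GKVVW

variable {σ : Type}

/-- Evaluation of a monomial along the ray `t • z`. [folklore] -/
theorem eval_smul_monomial (t : ℂ) (z : σ → ℂ) (e : σ →₀ ℕ) (a : ℂ) :
    eval (t • z) (monomial e a) = t ^ e.degree * eval z (monomial e a) := by
  simp only [eval_monomial, Finsupp.prod, Pi.smul_apply, smul_eq_mul, mul_pow,
    Finset.prod_mul_distrib, Finset.prod_pow_eq_pow_sum, Finsupp.degree_apply]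
  ring

/-- A homogeneous polynomial of degree `n` scales by `t ^ n` along rays. [folklore] -/
theorem eval_smul_of_isHomogeneous {φ : MvPolynomial σ ℂ} {n : ℕ} (hφ : φ.IsHomogeneous n)
    (t : ℂ) (z : σ → ℂ) : eval (t • z) φ = t ^ n * eval z φ := by
  conv_lhs => rw [φ.as_sum]
  conv_rhs => rw [φ.as_sum]
  rw [map_sum, map_sum, Finset.mul_sum]
  refine Finset.sum_congr rfl fun e he => ?_
  rw [eval_smul_monomial]
  congr 2
  have h := hφ (mem_support_iff.mp he)
  have h' : e.degree = Finsupp.weight (1 : σ → ℕ) e := by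
    rw [Finsupp.degree_eq_weight_one]; rfl
  rw [h', h]

/-- Ray expansion: `Q(t • z) = Σ_i t^i · Q_i(z)` with `Q_i` the homogeneous components. [folklore] -/
theorem eval_smul_eq_sum_homogeneousComponent (Q : MvPolynomial σ ℂ) (t : ℂ) (z : σ → ℂ) {n : ℕ}
    (hn : Q.totalDegree < n) :
    eval (t • z) Q = ∑ i ∈ range n, t ^ i * eval z (homogeneousComponent i Q) := by
  have hsum : ∑ i ∈ range n, homogeneousComponent i Q = Q := by
    rw [← Finset.sum_range_add_sum_Ico _ (Nat.succ_le_of_lt hn), sum_homogeneousComponent,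
      Finset.sum_eq_zero, add_zero]
    intro i hi
    exact homogeneousComponent_eq_zero _ _ (Nat.lt_of_succ_le (Finset.mem_Ico.mp hi).1)
  conv_lhs => rw [← hsum]
  rw [map_sum]
  refine Finset.sum_congr rfl fun i _ => ?_
  exact eval_smul_of_isHomogeneous (homogeneousComponent_isHomogeneous i Q) t z

/-- The ray evaluation `t ↦ Q(t • z)` is a polynomial function of `t`, hence differentiable.
[folklore] -/
theorem differentiable_eval_smul (Q : MvPolynomial σ ℂ) (z : σ → ℂ) :
    Differentiable ℂ (fun t : ℂ => eval (t • z) Q) := by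
  have : (fun t : ℂ => eval (t • z) Q) = fun t =>
      ∑ i ∈ range (Q.totalDegree + 1), t ^ i * eval z (homogeneousComponent i Q) :=
    funext fun t => eval_smul_eq_sum_homogeneousComponent Q t z (Nat.lt_succ_self _)
  rw [this]
  fun_prop

/-- **Coefficient extraction by a circle integral.** For a finite sum of monomials in `t`,
`∮_{|t|=R} (Σ_{i∈S} c i · t^{e i}) · t^{-(m+1)} dt = 2πi · Σ_{i ∈ S, e i = m} c i`. [folklore] -/
theorem circleIntegral_sum_mul_pow_mul_zpow {ι : Type*} (S : Finset ι) (c : ι → ℂ) (e : ι → ℕ)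
    (m : ℕ) {R : ℝ} (hR : 0 < R) :
    (∮ t in C(0, R), (∑ i ∈ S, c i * t ^ e i) * t ^ (-(m + 1 : ℤ))) =
      2 * π * I * ∑ i ∈ S with e i = m, c i := by
  classical
  have hsphere : ∀ t ∈ sphere (0 : ℂ) R, t ≠ 0 := fun t ht h0 => by
    rw [h0, mem_sphere, dist_self] at ht
    exact hR.ne' ht.symm
  -- rewrite the integrand on the circle as a sum of integer powers
  have hcongr : Set.EqOn (fun t : ℂ => (∑ i ∈ S, c i * t ^ e i) * t ^ (-(m + 1 : ℤ)))
      (fun t => ∑ i ∈ S, c i * (t - 0) ^ ((e i : ℤ) - (m + 1))) (sphere (0 : ℂ) R) := by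
    intro t ht
    simp only [sub_zero, Finset.sum_mul]
    refine Finset.sum_congr rfl fun i _ => ?_
    rw [mul_assoc, zpow_sub₀ (hsphere t ht), zpow_natCast, zpow_neg, div_eq_mul_inv]
  rw [circleIntegral.integral_congr hR.le hcongr]
  have h0R : (0 : ℂ) ∉ sphere (0 : ℂ) |R| := fun h => hsphere 0 (by rwa [abs_of_pos hR] at h) rfl
  have hint : ∀ i ∈ S, CircleIntegrable (fun t : ℂ => c i * (t - 0) ^ ((e i : ℤ) - (m + 1))) 0 R := by
    intro i _
    have h := (circleIntegrable_sub_zpow_iff.2 (Or.inr (Or.inr h0R)) :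
      CircleIntegrable (fun t : ℂ => (t - 0) ^ ((e i : ℤ) - (m + 1))) 0 R)
    exact h.const_fun_smul (a := c i)
  rw [circleIntegral.integral_fun_sum hint]
  have hterm : ∀ i ∈ S, (∮ t in C(0, R), c i * (t - 0) ^ ((e i : ℤ) - (m + 1))) =
      if e i = m then 2 * π * I * c i else 0 := by
    intro i _
    rw [circleIntegral.integral_const_mul]
    split_ifs with him
    · have : ((e i : ℤ) - (m + 1)) = -1 := by rw [him]; ring
      rw [this]
      simp only [zpow_neg, zpow_one]
      rw [circleIntegral.integral_sub_inv_of_mem_ball (mem_ball_self hR), mul_comm]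
    · rw [circleIntegral.integral_sub_zpow_of_ne, mul_zero]
      intro h
      apply him
      have : (e i : ℤ) = m := by linarith
      exact_mod_cast this
  rw [Finset.sum_congr rfl hterm, ← Finset.sum_filter, Finset.mul_sum]

/-! ### Kronecker substitution: coefficients are bounded by the sup over the closed polydisc -/

/-- Base-`D` digit vectors are determined by their value. [folklore] -/
theorem digits_injective {n D : ℕ} :
    ∀ f g : Fin n → ℕ, (∀ i, f i < D) → (∀ i, g i < D) →
      ∑ i, f i * D ^ (i : ℕ) = ∑ i, g i * D ^ (i : ℕ) → f = g := by
  induction n with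
  | zero => intro f g _ _ _; exact funext fun i => Fin.elim0 i
  | succ n ih =>
    intro f g hf hg hsum
    have hD : 0 < D := lt_of_le_of_lt (Nat.zero_le _) (hf 0)
    have split : ∀ h : Fin (n + 1) → ℕ,
        ∑ i, h i * D ^ (i : ℕ) = h 0 + D * ∑ i : Fin n, h i.succ * D ^ (i : ℕ) := by
      intro h
      rw [Fin.sum_univ_succ, Finset.mul_sum]
      simp only [Fin.val_zero, pow_zero, mul_one, Fin.val_succ, pow_succ]
      congr 1
      refine Finset.sum_congr rfl fun i _ => ?_
      ring
    rw [split f, split g] at hsum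
    have h0 : f 0 = g 0 := by
      have := congrArg (· % D) hsum
      simpa [Nat.add_mul_mod_self_left, Nat.mod_eq_of_lt (hf 0), Nat.mod_eq_of_lt (hg 0)] using this
    have htail : (fun i : Fin n => f i.succ) = fun i => g i.succ := by
      apply ih
      · exact fun i => hf _
      · exact fun i => hg _
      · have := congrArg (· / D) hsum
        simpa [Nat.add_mul_div_left _ _ hD, Nat.div_eq_of_lt (hf 0), Nat.div_eq_of_lt (hg 0)]
          using this
    funext i
    refine Fin.cases h0 (fun j => ?_) i
    exact congrFun htail j

variable [Fintype σ]

/-- **Coefficient bound.** If `|Q(z)| ≤ C` on the closed unit polydisc then every coefficient of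
`Q` has modulus `≤ C` (Cauchy estimate on the circle after the Kronecker substitution
`z_j = t^{D^j}`). [folklore] -/
theorem norm_coeff_le_of_forall_norm_eval_le (Q : MvPolynomial σ ℂ) {C : ℝ}
    (hC : ∀ z : σ → ℂ, (∀ j, ‖z j‖ ≤ 1) → ‖eval z Q‖ ≤ C) (α : σ →₀ ℕ) :
    ‖coeff α Q‖ ≤ C := by
  classical
  by_cases hα : α ∈ Q.support
  swap
  · rw [notMem_support_iff.mp hα, norm_zero]
    exact le_trans (norm_nonneg _) (hC 0 fun j => by simp)
  -- Kronecker substitution data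
  set e := Fintype.equivFin σ with he
  set D := Q.totalDegree + 1 with hD
  let w : σ → ℕ := fun j => D ^ (e j : ℕ)
  let N : (σ →₀ ℕ) → ℕ := fun γ => ∑ j, γ j * w j
  have hlt : ∀ γ ∈ Q.support, ∀ j, γ j < D := by
    intro γ hγ j
    have h1 : γ j ≤ γ.degree := by
      rw [Finsupp.degree_eq_sum]
      exact Finset.single_le_sum (fun i _ => Nat.zero_le (γ i)) (Finset.mem_univ j)
    have h2 : γ.degree ≤ Q.totalDegree := by
      have := le_totalDegree hγ
      rwa [Finsupp.degree_apply]
    omega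
  have hinj : ∀ γ ∈ Q.support, ∀ γ' ∈ Q.support, N γ = N γ' → γ = γ' := by
    intro γ hγ γ' hγ' hN
    have key := digits_injective (n := Fintype.card σ) (D := D) (fun i => γ (e.symm i))
      (fun i => γ' (e.symm i)) (fun i => hlt γ hγ _) (fun i => hlt γ' hγ' _) ?_
    · ext j
      have := congrFun key (e j)
      simpa using this
    · -- reindex the sums along `e`
      have hre : ∀ δ : σ →₀ ℕ, ∑ i : Fin (Fintype.card σ), δ (e.symm i) * D ^ (i : ℕ) = N δ := by
        intro δ
        simp only [N, w]
        exact e.symm.sum_comp (fun j => δ j * D ^ (e j : ℕ)) |>.trans (by simp) |>.symm.trans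
          (by simp) |>.symm
      rw [hre, hre]; exact hN
  -- the one-variable polynomial `φ(t) = Q(t^{w_1}, …)`
  have hφ : ∀ t : ℂ, eval (fun j => t ^ w j) Q = ∑ γ ∈ Q.support, coeff γ Q * t ^ N γ := by
    intro t
    conv_lhs => rw [Q.as_sum]
    rw [map_sum]
    refine Finset.sum_congr rfl fun γ _ => ?_
    rw [eval_monomial, Finsupp.prod_fintype]
    · simp only [N, ← pow_mul, Finset.prod_pow_eq_pow_sum, mul_comm (w _)]
    · intro j; simp
  -- coefficient extraction
  have hext := circleIntegral_sum_mul_pow_mul_zpow Q.support (fun γ => coeff γ Q) N (N α)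
    zero_lt_one
  have hfilter : ∑ γ ∈ Q.support with N γ = N α, coeff γ Q = coeff α Q := by
    rw [Finset.sum_filter, Finset.sum_eq_single_of_mem α hα]
    · rw [if_pos rfl]
    · intro γ hγ hne
      rw [if_neg]
      exact fun h => hne (hinj γ hγ α hα h)
  rw [hfilter] at hext
  -- norm estimate on the unit circle
  have hbound : ∀ t ∈ sphere (0 : ℂ) 1,
      ‖(∑ γ ∈ Q.support, coeff γ Q * t ^ N γ) * t ^ (-(N α + 1 : ℤ))‖ ≤ C := by
    intro t ht
    have ht1 : ‖t‖ = 1 := by simpa using ht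
    rw [norm_mul, norm_zpow, ht1, one_zpow, mul_one, ← hφ]
    exact hC _ fun j => by simp [ht1]
  have hnorm := circleIntegral.norm_integral_le_of_norm_le_const zero_le_one hbound
  rw [hext] at hnorm
  have h2π : ‖(2 * π * I : ℂ)‖ = 2 * π := by simp [Real.pi_pos.le]
  rw [norm_mul, h2π] at hnorm
  nlinarith [Real.pi_pos, norm_nonneg (coeff α Q)]

/-! ### Cauchy estimates for the inverse power series of a zero-free polynomial -/

section InverseSeries

variable (P : MvPolynomial σ ℂ)

omit [Fintype σ] in
/-- The constant coefficient of `P` seen as a power series. [folklore] -/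
theorem constantCoeff_coe_ne_zero (hP0 : constantCoeff P ≠ 0) :
    MvPowerSeries.constantCoeff (P : MvPowerSeries σ ℂ) ≠ 0 := by
  rwa [← MvPowerSeries.coeff_zero_eq_constantCoeff_apply, MvPolynomial.coeff_coe,
    ← MvPolynomial.constantCoeff_eq]

/-- Truncation of the inverse series: in degree `< n`, `P · truncTotal n (P⁻¹) ≡ 1`. [folklore] -/
theorem coeff_mul_truncTotal_inv (hP0 : constantCoeff P ≠ 0) {n : ℕ} (γ : σ →₀ ℕ)
    (hγ : γ.degree < n) :
    coeff γ (P * MvPowerSeries.truncTotal n ((P : MvPowerSeries σ ℂ)⁻¹)) =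
      coeff γ (1 : MvPolynomial σ ℂ) := by
  classical
  have hinv : (P : MvPowerSeries σ ℂ) * (P : MvPowerSeries σ ℂ)⁻¹ = 1 :=
    MvPowerSeries.mul_inv_cancel _ (constantCoeff_coe_ne_zero P hP0)
  have h1 : MvPowerSeries.coeff γ ((P : MvPowerSeries σ ℂ) * (P : MvPowerSeries σ ℂ)⁻¹) =
      coeff γ (1 : MvPolynomial σ ℂ) := by
    rw [hinv, MvPowerSeries.coeff_one, MvPolynomial.coeff_one]
    by_cases h : γ = 0
    · simp [h]
    · simp [h, Ne.symm h]
  rw [← h1, MvPolynomial.coeff_mul, MvPowerSeries.coeff_mul]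
  refine Finset.sum_congr rfl fun x hx => ?_
  rw [MvPolynomial.coeff_coe, MvPowerSeries.coeff_truncTotal]
  have hle : x.2 ≤ γ := by
    rw [Finset.mem_antidiagonal] at hx
    rw [← hx]; exact le_add_self
  exact lt_of_le_of_lt (Finsupp.degree_mono hle) hγ

/-- The defect `E = P · truncTotal (k+1) P⁻¹ − 1` has no homogeneous component of degree `≤ k`.
[folklore] -/
theorem homogeneousComponent_defect_eq_zero (hP0 : constantCoeff P ≠ 0) {k i : ℕ} (hi : i ≤ k) :
    homogeneousComponent i (P * MvPowerSeries.truncTotal (k + 1) ((P : MvPowerSeries σ ℂ)⁻¹) - 1) =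
      0 := by
  classical
  ext γ
  rw [coeff_homogeneousComponent, coeff_zero]
  split_ifs with hγ
  · rw [coeff_sub, coeff_mul_truncTotal_inv P hP0 γ (by omega), sub_self]
  · rfl

/-- Ray evaluation of the defect: `E(t • z) = t^{k+1} · h̃(t)` with `h̃` a polynomial in `t`.
[folklore] -/
theorem eval_smul_defect (hP0 : constantCoeff P ≠ 0) (k : ℕ) (z : σ → ℂ) (t : ℂ) :
    let E := P * MvPowerSeries.truncTotal (k + 1) ((P : MvPowerSeries σ ℂ)⁻¹) - 1
    eval (t • z) E = t ^ (k + 1) *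
      ∑ i ∈ Finset.Ico (k + 1) (E.totalDegree + k + 2),
        t ^ (i - (k + 1)) * eval z (homogeneousComponent i E) := by
  intro E
  have hn : E.totalDegree < E.totalDegree + k + 2 := by omega
  rw [eval_smul_eq_sum_homogeneousComponent E t z hn,
    ← Finset.sum_range_add_sum_Ico _ (show k + 1 ≤ E.totalDegree + k + 2 by omega),
    Finset.sum_eq_zero, zero_add, Finset.mul_sum]
  · refine Finset.sum_congr rfl fun i hi => ?_
    have hik : k + 1 ≤ i := (Finset.mem_Ico.mp hi).1
    rw [← mul_assoc, ← pow_add, Nat.add_sub_cancel' hik]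
  · intro i hi
    rw [homogeneousComponent_defect_eq_zero P hP0 (Nat.lt_succ_iff.mp (Finset.mem_range.mp hi)),
      map_zero, mul_zero]

/-- **Homogeneous Cauchy representation.** If `P` has no zero on the closed polydisc of radius
`r`, then for `z` in the closed unit polydisc the degree-`k` homogeneous part of `P⁻¹` at `z` is
`(2πi)⁻¹ ∮_{|t|=r} P(tz)⁻¹ t^{-(k+1)} dt`. [folklore] -/
theorem circleIntegral_inv_eval_smul {r : ℝ} (hr : 0 < r)
    (hP : ∀ w : σ → ℂ, (∀ j, ‖w j‖ ≤ r) → eval w P ≠ 0) {z : σ → ℂ} (hz : ∀ j, ‖z j‖ ≤ 1)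
    (k : ℕ) :
    (∮ t in C(0, r), (eval (t • z) P)⁻¹ * t ^ (-(k + 1 : ℤ))) =
      2 * π * I * eval z (homogeneousComponent k
        (MvPowerSeries.truncTotal (k + 1) ((P : MvPowerSeries σ ℂ)⁻¹))) := by
  classical
  have hP0 : constantCoeff P ≠ 0 := by
    have := hP 0 fun j => by simpa using hr.le
    rwa [MvPolynomial.eval_zero] at this
  set B := MvPowerSeries.truncTotal (k + 1) ((P : MvPowerSeries σ ℂ)⁻¹) with hB
  set E := P * B - 1 with hE
  -- `f t = P(tz)` has no zero for `‖t‖ ≤ r`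
  set f : ℂ → ℂ := fun t => eval (t • z) P with hf
  have hfne : ∀ t : ℂ, ‖t‖ ≤ r → f t ≠ 0 := by
    intro t ht
    apply hP
    intro j
    rw [Pi.smul_apply, smul_eq_mul, norm_mul]
    calc ‖t‖ * ‖z j‖ ≤ r * 1 := mul_le_mul ht (hz j) (norm_nonneg _) hr.le
      _ = r := mul_one r
  -- the polynomial `h̃`
  set htil : ℂ → ℂ := fun t => ∑ i ∈ Finset.Ico (k + 1) (E.totalDegree + k + 2),
      t ^ (i - (k + 1)) * eval z (homogeneousComponent i E) with hhtil
  have hEt : ∀ t, eval (t • z) E = t ^ (k + 1) * htil t := fun t => eval_smul_defect P hP0 k z t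
  -- the identity `f⁻¹ t^{-(k+1)} = B(tz) t^{-(k+1)} - h̃/f` on the circle
  set n := B.totalDegree + k + 2 with hn
  have hBt : ∀ t, eval (t • z) B = ∑ i ∈ range n, eval z (homogeneousComponent i B) * t ^ i := by
    intro t
    rw [eval_smul_eq_sum_homogeneousComponent B t z (show B.totalDegree < n by omega)]
    exact Finset.sum_congr rfl fun i _ => mul_comm _ _
  have hsphere : ∀ t ∈ sphere (0 : ℂ) r, t ≠ 0 ∧ ‖t‖ = r := fun t ht => by
    have : ‖t‖ = r := by simpa using ht
    exact ⟨fun h0 => hr.ne' (by rw [← this, h0, norm_zero]), this⟩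
  have hcongr : Set.EqOn (fun t : ℂ => (f t)⁻¹ * t ^ (-(k + 1 : ℤ)))
      (fun t => (∑ i ∈ range n, eval z (homogeneousComponent i B) * t ^ i) * t ^ (-(k + 1 : ℤ)) -
        htil t / f t) (sphere (0 : ℂ) r) := by
    intro t ht
    obtain ⟨ht0, htr⟩ := hsphere t ht
    have hft : f t ≠ 0 := hfne t htr.le
    have hprod : f t * eval (t • z) B = 1 + t ^ (k + 1) * htil t := by
      rw [← hEt, hE, map_sub, map_mul, map_one]; ring
    have hB' : eval (t • z) B = (1 + t ^ (k + 1) * htil t) / f t := by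
      rw [eq_div_iff hft, mul_comm]; exact hprod
    have hu : t ^ (-(k + 1 : ℤ)) = (t ^ (k + 1))⁻¹ := by
      rw [zpow_neg, ← Nat.cast_succ, zpow_natCast]
    simp only
    rw [← hBt, hB', hu]
    field_simp
    ring
  rw [circleIntegral.integral_congr hr.le hcongr]
  -- integrability of the two parts on the circle
  have hcont_f : Continuous f := (differentiable_eval_smul P z).continuous
  have hcont_htil : Continuous htil := by
    simp only [hhtil]
    fun_prop
  have hint1 : CircleIntegrable (fun t : ℂ =>
      (∑ i ∈ range n, eval z (homogeneousComponent i B) * t ^ i) * t ^ (-(k + 1 : ℤ))) 0 r := by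
    refine ContinuousOn.circleIntegrable hr.le (continuousOn_of_forall_continuousAt ?_)
    intro t ht
    have ht0 : t ≠ 0 := (hsphere t ht).1
    refine ContinuousAt.mul (by fun_prop) ?_
    exact (continuousAt_zpow₀ _ _ (Or.inl ht0))
  have hint2 : CircleIntegrable (fun t : ℂ => htil t / f t) 0 r := by
    refine ContinuousOn.circleIntegrable hr.le (continuousOn_of_forall_continuousAt ?_)
    intro t ht
    exact (hcont_htil.continuousAt).div hcont_f.continuousAt (hfne t (hsphere t ht).2.le)
  rw [circleIntegral.integral_sub hint1 hint2]
  -- the polynomial part: coefficient extraction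
  rw [circleIntegral_sum_mul_pow_mul_zpow (range n) (fun i => eval z (homogeneousComponent i B))
    (fun i => i) k hr]
  have hk : ∑ i ∈ range n with i = k, eval z (homogeneousComponent i B) =
      eval z (homogeneousComponent k B) := by
    rw [Finset.sum_filter, Finset.sum_ite_eq', if_pos (Finset.mem_range.mpr (by omega))]
  rw [hk]
  -- the analytic part vanishes by Cauchy's theorem
  have hcauchy : (∮ t in C(0, r), htil t / f t) = 0 := by
    refine Complex.circleIntegral_eq_zero_of_differentiable_on_off_countable hr.le
      Set.countable_empty ?_ ?_
    · refine continuousOn_of_forall_continuousAt fun t ht => ?_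
      exact (hcont_htil.continuousAt).div hcont_f.continuousAt
        (hfne t (by simpa using (mem_closedBall.mp ht)))
    · intro t ht
      have ht' : ‖t‖ ≤ r := by simpa using (mem_ball.mp ht.1).le
      refine DifferentiableAt.div ?_ ((differentiable_eval_smul P z) t) (hfne t ht')
      simp only [hhtil]
      fun_prop
  rw [hcauchy, sub_zero]

/-- **Cauchy estimate for the inverse series.** If `P` has no zero on the closed polydisc of
radius `r > 0` and `‖P(w)⁻¹‖ ≤ K` there, then `‖[z^α] P⁻¹‖ ≤ K · r^{-|α|}`. [folklore] -/
theorem norm_coeff_inv_le {r : ℝ} (hr : 0 < r)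
    (hP : ∀ w : σ → ℂ, (∀ j, ‖w j‖ ≤ r) → eval w P ≠ 0) {K : ℝ}
    (hK : ∀ w : σ → ℂ, (∀ j, ‖w j‖ ≤ r) → ‖(eval w P)⁻¹‖ ≤ K) (α : σ →₀ ℕ) :
    ‖MvPowerSeries.coeff α ((P : MvPowerSeries σ ℂ)⁻¹)‖ ≤ K * r⁻¹ ^ α.degree := by
  classical
  set k := α.degree with hk
  set H := homogeneousComponent k (MvPowerSeries.truncTotal (k + 1) ((P : MvPowerSeries σ ℂ)⁻¹))
    with hH
  have hcoeff : coeff α H = MvPowerSeries.coeff α ((P : MvPowerSeries σ ℂ)⁻¹) := by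
    rw [hH, coeff_homogeneousComponent, if_pos hk.symm, MvPowerSeries.coeff_truncTotal]
    omega
  rw [← hcoeff]
  have hK0 : 0 ≤ K := le_trans (norm_nonneg _) (hK 0 fun j => by simpa using hr.le)
  refine norm_coeff_le_of_forall_norm_eval_le H (fun z hz => ?_) α
  -- bound on the unit polydisc from the circle integral
  have hint := circleIntegral_inv_eval_smul P hr hP hz k
  have hbound : ∀ t ∈ sphere (0 : ℂ) r,
      ‖(eval (t • z) P)⁻¹ * t ^ (-(k + 1 : ℤ))‖ ≤ K * r⁻¹ ^ (k + 1) := by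
    intro t ht
    have htr : ‖t‖ = r := by simpa using ht
    have htz : ∀ j, ‖(t • z) j‖ ≤ r := fun j => by
      rw [Pi.smul_apply, smul_eq_mul, norm_mul, htr]
      calc r * ‖z j‖ ≤ r * 1 := mul_le_mul_of_nonneg_left (hz j) hr.le
        _ = r := mul_one r
    rw [norm_mul, norm_zpow, htr, zpow_neg, ← Nat.cast_succ, zpow_natCast, ← inv_pow]
    exact mul_le_mul_of_nonneg_right (hK _ htz) (by positivity)
  have hnorm := circleIntegral.norm_integral_le_of_norm_le_const hr.le hbound
  rw [hint, norm_mul] at hnorm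
  have h2π : ‖(2 * π * I : ℂ)‖ = 2 * π := by simp [Real.pi_pos.le]
  rw [h2π, pow_succ] at hnorm
  have hr' : r * (K * (r⁻¹ ^ k * r⁻¹)) = K * r⁻¹ ^ k := by field_simp
  nlinarith [Real.pi_pos, norm_nonneg (eval z H), hr']

/-- Geometric summability over multi-indices: `Σ_α x^{|α|} < ∞` for `0 ≤ x < 1`. [folklore] -/
theorem summable_pow_degree {x : ℝ} (hx0 : 0 ≤ x) (hx1 : x < 1) :
    Summable fun α : σ →₀ ℕ => x ^ α.degree := by
  classical
  -- dominating constant: `Σ_k (k+1)^c x^k`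
  set c := Fintype.card σ with hc
  have hgeo : Summable fun k : ℕ => ((k + 1 : ℕ) : ℝ) ^ c * x ^ k := by
    have h := summable_pow_mul_geometric_of_norm_lt_one c (show ‖x‖ < 1 by
      rwa [Real.norm_eq_abs, abs_of_nonneg hx0])
    rw [← summable_nat_add_iff 1] at h
    by_cases hx : x = 0
    · subst hx
      refine summable_of_ne_finset_zero (s := {0}) fun k hk => ?_
      rw [Finset.mem_singleton] at hk
      simp [zero_pow hk]
    · have : (fun k : ℕ => ((k + 1 : ℕ) : ℝ) ^ c * x ^ k) =
          fun k => x⁻¹ * (((k + 1 : ℕ) : ℝ) ^ c * x ^ (k + 1)) := by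
        funext k; rw [pow_succ]; field_simp
      rw [this]
      exact h.mul_left _
  set C := ∑' k : ℕ, ((k + 1 : ℕ) : ℝ) ^ c * x ^ k with hC
  refine summable_of_sum_le (fun α => by positivity) (c := C) fun u => ?_
  -- enlarge `u` to all multi-indices of degree `≤ m`
  obtain ⟨m, hm⟩ : ∃ m, ∀ α ∈ u, α.degree ≤ m :=
    ⟨u.sup Finsupp.degree, fun α hα => Finset.le_sup (f := Finsupp.degree) hα⟩
  set T := (Finsupp.finite_of_degree_le (σ := σ) m).toFinset with hT
  have huT : u ⊆ T := fun α hα => by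
    rw [hT, Set.Finite.mem_toFinset]; exact hm α hα
  calc ∑ α ∈ u, x ^ α.degree ≤ ∑ α ∈ T, x ^ α.degree :=
        Finset.sum_le_sum_of_subset_of_nonneg huT fun _ _ _ => by positivity
    _ = ∑ k ∈ range (m + 1), ∑ α ∈ T with α.degree = k, x ^ α.degree := by
        rw [Finset.sum_fiberwise_of_maps_to]
        intro α hα
        rw [hT, Set.Finite.mem_toFinset] at hα
        exact Finset.mem_range.mpr (Nat.lt_succ_of_le hα)
    _ = ∑ k ∈ range (m + 1), ((T.filter fun α => α.degree = k).card : ℝ) * x ^ k := by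
        refine Finset.sum_congr rfl fun k _ => ?_
        rw [Finset.sum_congr rfl fun α hα => by rw [(Finset.mem_filter.mp hα).2],
          Finset.sum_const, nsmul_eq_mul]
    _ ≤ ∑ k ∈ range (m + 1), ((k + 1 : ℕ) : ℝ) ^ c * x ^ k := by
        refine Finset.sum_le_sum fun k _ => ?_
        refine mul_le_mul_of_nonneg_right ?_ (by positivity)
        -- `#{α : |α| = k} ≤ (k+1)^c` by the injection `α ↦ (j ↦ α j) ∈ (Fin (k+1))^σ`
        have hcard : (T.filter fun α => α.degree = k).card ≤
            (Finset.univ : Finset (σ → Fin (k + 1))).card := by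
          refine Finset.card_le_card_of_injOn
            (fun α => fun j => ⟨min (α j) k, by omega⟩) (fun _ _ => Finset.mem_univ _) ?_
          intro α hα β hβ hαβ
          have hαk : ∀ j, α j ≤ k := fun j => by
            have h1 : α j ≤ α.degree := by
              rw [Finsupp.degree_eq_sum]
              exact Finset.single_le_sum (fun i _ => Nat.zero_le (α i)) (Finset.mem_univ j)
            rw [(Finset.mem_filter.mp (Finset.mem_coe.mp hα)).2] at h1; exact h1
          have hβk : ∀ j, β j ≤ k := fun j => by
            have h1 : β j ≤ β.degree := by
              rw [Finsupp.degree_eq_sum]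
              exact Finset.single_le_sum (fun i _ => Nat.zero_le (β i)) (Finset.mem_univ j)
            rw [(Finset.mem_filter.mp (Finset.mem_coe.mp hβ)).2] at h1; exact h1
          ext j
          have := congrFun hαβ j
          simp only [Fin.mk.injEq, min_eq_left (hαk j), min_eq_left (hβk j)] at this
          exact this
        rw [Finset.card_univ, Fintype.card_fun, Fintype.card_fin] at hcard
        exact_mod_cast hcard
    _ ≤ C := by
        exact hgeo.sum_le_tsum (range (m + 1)) (fun k _ => by positivity)

/-- **Absolute summability of the inverse series.** If `P` has no zero on a closed polydisc of
radius `r > 1`, the Taylor coefficients of `1/P` are absolutely summable (the content of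
"`‖g_ρ‖_𝒜 < ∞`" in the proof of GrinshpanEtAl2015 Thm. 3.1, there via GrinshpanEtAl2016
Lemma 3.3). [folklore] -/
theorem summable_norm_coeff_inv {r : ℝ} (hr : 1 < r)
    (hP : ∀ w : σ → ℂ, (∀ j, ‖w j‖ ≤ r) → eval w P ≠ 0) :
    Summable fun α : σ →₀ ℕ => ‖MvPowerSeries.coeff α ((P : MvPowerSeries σ ℂ)⁻¹)‖ := by
  have hr0 : 0 < r := lt_trans zero_lt_one hr
  -- a uniform bound for `‖P(w)⁻¹‖` on the compact polydisc
  have hcpt : IsCompact (Metric.closedBall (0 : σ → ℂ) r) := isCompact_closedBall _ _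
  have hmem : ∀ w : σ → ℂ, w ∈ Metric.closedBall (0 : σ → ℂ) r ↔ ∀ j, ‖w j‖ ≤ r := by
    intro w
    rw [mem_closedBall, dist_zero_right, pi_norm_le_iff_of_nonneg hr0.le]
  have hcont : ContinuousOn (fun w : σ → ℂ => (eval w P)⁻¹) (Metric.closedBall 0 r) := by
    refine continuousOn_of_forall_continuousAt fun w hw => ?_
    exact (MvPolynomial.continuous_eval P).continuousAt.inv₀ (hP w ((hmem w).mp hw))
  obtain ⟨K, hK⟩ := hcpt.exists_bound_of_continuousOn hcont
  have hK' : ∀ w : σ → ℂ, (∀ j, ‖w j‖ ≤ r) → ‖(eval w P)⁻¹‖ ≤ K :=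
    fun w hw => hK w ((hmem w).mpr hw)
  have hK0 : 0 ≤ K := le_trans (norm_nonneg _) (hK' 0 fun j => by simpa using hr0.le)
  refine Summable.of_nonneg_of_le (fun _ => norm_nonneg _) (norm_coeff_inv_le P hr0 hP hK') ?_
  exact (summable_pow_degree (inv_nonneg.mpr hr0.le) (inv_lt_one_of_one_lt₀ hr)).mul_left K

/-- **Stability margin.** A polynomial with no zero on the closed unit polydisc has no zero on a
slightly larger closed polydisc (compactness; the first line of the proof of GrinshpanEtAl2015
Thm. 3.1). [folklore] -/
theorem exists_radius_gt_one_of_noZero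
    (hP : ∀ w : σ → ℂ, (∀ j, ‖w j‖ ≤ 1) → eval w P ≠ 0) :
    ∃ r : ℝ, 1 < r ∧ ∀ w : σ → ℂ, (∀ j, ‖w j‖ ≤ r) → eval w P ≠ 0 := by
  by_contra! hcon
  -- zeros `w_n` with `‖w_n‖ ≤ 1 + 1/(n+1)` accumulate at a zero in the closed unit polydisc
  have hmem : ∀ (ρ : ℝ) (w : σ → ℂ), 0 ≤ ρ →
      (w ∈ Metric.closedBall (0 : σ → ℂ) ρ ↔ ∀ j, ‖w j‖ ≤ ρ) := by
    intro ρ w hρ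
    rw [mem_closedBall, dist_zero_right, pi_norm_le_iff_of_nonneg hρ]
  choose w hw hw0 using fun n : ℕ => hcon (1 + 1 / (n + 1 : ℝ)) (by
    have : (0 : ℝ) < 1 / (n + 1 : ℝ) := by positivity
    linarith)
  have hcpt : IsCompact (Metric.closedBall (0 : σ → ℂ) 2) := isCompact_closedBall _ _
  have hwin : ∀ n, w n ∈ Metric.closedBall (0 : σ → ℂ) 2 := by
    intro n
    rw [hmem 2 _ zero_le_two]
    intro j
    refine le_trans (hw n j) ?_
    have : (1 : ℝ) / (n + 1 : ℝ) ≤ 1 := by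
      rw [div_le_one (by positivity)]; linarith [n.cast_nonneg (α := ℝ)]
    linarith
  obtain ⟨w₀, -, φ, hφ, hlim⟩ := hcpt.tendsto_subseq hwin
  -- `P(w₀) = 0`
  have hzero : eval w₀ P = 0 := by
    have h1 : Filter.Tendsto (fun n => eval (w (φ n)) P) Filter.atTop (nhds (eval w₀ P)) :=
      ((MvPolynomial.continuous_eval P).tendsto w₀).comp hlim
    have h2 : (fun n => eval (w (φ n)) P) = fun _ => 0 := funext fun n => hw0 (φ n)
    rw [h2] at h1
    exact tendsto_nhds_unique h1 tendsto_const_nhds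
  -- `‖w₀ j‖ ≤ 1`
  have hnorm : ∀ j, ‖w₀ j‖ ≤ 1 := by
    intro j
    have hj : Filter.Tendsto (fun n => ‖w (φ n) j‖) Filter.atTop (nhds ‖w₀ j‖) := by
      have := (((continuous_apply j).tendsto w₀).comp hlim).norm
      exact this
    have hb : Filter.Tendsto (fun n : ℕ => 1 + 1 / ((φ n : ℕ) + 1 : ℝ)) Filter.atTop (nhds 1) := by
      have h0 : Filter.Tendsto (fun n : ℕ => 1 / ((n : ℝ) + 1)) Filter.atTop (nhds 0) :=
        tendsto_one_div_add_atTop_nhds_zero_nat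
      have := (h0.comp hφ.tendsto_atTop).const_add 1
      simpa using this
    exact le_of_tendsto_of_tendsto' hj hb fun n => hw (φ n) j
  exact hP w₀ hnorm hzero

end InverseSeries

end GKVVW
end Literature.Analysis.OperatorTheory
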